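import Summits.QuantumAdvantage.QuantumAdvantage.Theses.ShorLocallyDark

/-!
# Refutation of `ShorLocallyDark.MixedMarginalsDark` (stmt-QuantumAdvantage-8592)

The crux counts "exceptional" pairs `(N, a)` — `N = p·q` a product of two distinct primes with
`2^(n-1) < N < 2^n`, `a < N` a unit — for which some reduced-density-matrix entry of Shor's
register deviates from the `a`-independent reference, and asks that they number at most
`2^((2-c)·n)` for all large `n`. The semiprime clause admits `p = 2`. For `N = 2q` and odd `a`,
`a^x mod N` is odd for every `x`, so with `S = ∅`, `T = {0}`, `b = b' = 0` the entry is `0` while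
the reference `#{z < N : z even}/N` is `1/2`; since `2⁻¹·N^(-c) < 1/2`, EVERY pair
`(2q, 2k+1)` with `q` prime in `(2^(n-2), 2^(n-1)]` and `k < 2^(n-3)` is exceptional (`log n ≤ c·n`
for large `n`). By Chebyshev's bounds on `θ` (Mathlib `Chebyshev.theta_ge`,
`Chebyshev.theta_le_log4_mul_x`) the interval `(4^j, 4^(j+1)]` holds at least `4^j/(2(j+1))`
primes for `j ≥ 6`, so one of its two dyadic halves holds `4^j/(4(j+1))`; with `n ∈ {2j+2, 2j+3}`
the family has `≥ 2^(2n-7)/(j+1)` members, which exceeds `2^((2-c)n)` as soon as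
`2^(2cj) > 256 (j+1)`. Hence the statement fails for every `c > 0`.
The intended statement needs odd (indeed balanced, `p, q ≥ N^(1/3)`) moduli; see the item's
evidence file. Everything is proved inside the single refutation theorem (no auxiliary
declarations). Route review 2026-08-15, refuter-rreview-0815T13-1-0.

Repair 2026-08-16: route `ShorLocallyDark` dropped the refuted item at rev 4 (2026-08-15T16:21:40Z;
superseded by the balanced `MixedMarginalsDarkR`), so the gate-written route file no longer declares
the constant `Summit.QuantumAdvantage.QuantumAdvantage.Theses.ShorLocallyDark.MixedMarginalsDark`,
while this refutation — a Theorems file, append-only, whose statement text `¬ MixedMarginalsDark` may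
not change — still names it ("Unknown identifier", full build of 2026-08-16). The constant is therefore
re-declared below under its ORIGINAL fully-qualified name with its ORIGINAL definiens (the item's ledger
signature, verbatim), in the route file's namespace and `open` context; it is NOT a route item (no
`route_item` attribute) and it is FALSE (the theorem below). Same device as
`Theorems/DebrisQuantaRobustDecayQuantumRecord.lean` of AnomalousDissipation; the theorem is unchanged.
-/

namespace Summit.QuantumAdvantage.QuantumAdvantage.Theses.ShorLocallyDark

open scoped BigOperators Topology Manifold Classical MeasureTheory ProbabilityTheory Matrix InnerProductSpace ComplexConjugate ContinuousMap
open Filter Set Function TopologicalSpace MeasureTheory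

/-- **Record of the dropped route item `MixedMarginalsDark`** = stmt-QuantumAdvantage-8592 (ledger
signature verbatim; NOT a route item; FALSE — `Theorems.ShorLocallyDarkMixedMarginalsDark_refuted`):
for some `c > 0` and all large `n`, the pairs `(N, a)` with `N = p·q < 2^n` a product of two distinct
primes, `2^(n-1) < N`, `a < N` a unit, for which some reduced-density-matrix entry of Shor's register
(cells `S`, `T`, patterns `u, u', b, b'` of total size `≤ c n / log n`) deviates from the
`a`-independent reference by more than `2^{-(|S|+|T|)} N^{-c}`, number at most `2^((2-c) n)`; refuted
because the semiprime clause admits `p = 2`. Re-declared only so that the refutation record keeps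
elaborating (see the module docstring). -/
def MixedMarginalsDark : Prop :=
  ∃ c : ℝ, 0 < c ∧ ∃ n₀ : ℕ, ∀ n ≥ n₀, (((Finset.range (2 ^ n) ×ˢ Finset.range (2 ^ n)).filter fun Na : ℕ × ℕ => (∃ p q : ℕ, p.Prime ∧ q.Prime ∧ p ≠ q ∧ Na.1 = p * q) ∧ 2 ^ (n - 1) < Na.1 ∧ Na.2 < Na.1 ∧ Nat.Coprime Na.2 Na.1 ∧ ∃ (S : Finset (Fin (2 * n))) (T : Finset (Fin n)) (u u' : Fin (2 * n) → Bool) (b b' : Fin n → Bool), ((S.card + T.card : ℕ) : ℝ) * Real.log n ≤ c * n ∧ (2 : ℝ) ^ (-((S.card + T.card : ℕ) : ℝ)) * (Na.1 : ℝ) ^ (-c) < |((((Finset.univ : Finset (Fin (2 * n) → Bool)).filter fun y => (∀ i ∈ T, (Na.2 ^ Nat.ofBits (S.piecewise u y) % Na.1).testBit (i : ℕ) = b i) ∧ (∀ i ∈ T, (Na.2 ^ Nat.ofBits (S.piecewise u' y) % Na.1).testBit (i : ℕ) = b' i) ∧ (∀ i : Fin n, i ∉ T → (Na.2 ^ Nat.ofBits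 (S.piecewise u y) % Na.1).testBit (i : ℕ) = (Na.2 ^ Nat.ofBits (S.piecewise u' y) % Na.1).testBit (i : ℕ))).card : ℝ) / (2 : ℝ) ^ (2 * n + S.card)) - (if (∀ j ∈ S, u j = u' j) ∧ (∀ i ∈ T, b i = b' i) then (((Finset.range Na.1).filter fun z => ∀ i ∈ T, z.testBit (i : ℕ) = b i).card : ℝ) / ((Na.1 : ℝ) * (2 : ℝ) ^ S.card) else 0)|).card : ℝ) ≤ (2 : ℝ) ^ ((2 - c) * n)

end Summit.QuantumAdvantage.QuantumAdvantage.Theses.ShorLocallyDark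

open Finset Real Filter Topology

namespace Summit.QuantumAdvantage.QuantumAdvantage.Theorems

open Summit.QuantumAdvantage.QuantumAdvantage.Theses.ShorLocallyDark

/-- Refutes `ShorLocallyDark.MixedMarginalsDark`: the even semiprimes `N = 2q` with odd units
`a = 2k+1` (witness cell `S = ∅`, `T = {0}`, `b = b' = 0`: entry `0` versus reference `1/2`) are
exceptional and number `≫ 2^((2-c)n)` for every `c > 0`, by Chebyshev's `θ` bounds; witness
`(N, a) = (2q, 2k+1)`. [folklore] -/
theorem ShorLocallyDarkMixedMarginalsDark_refuted : ¬ MixedMarginalsDark := by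
  /- 1. An elementary growth inequality absorbing the error terms of Chebyshev's bounds. -/
  have key_nat : ∀ j : ℕ, 6 ≤ j → 2 * j + 3 + 8 * (j + 1) * 2 ^ j ≤ 4 ^ j := by
    intro j hj
    induction j, hj using Nat.le_induction with
    | base => norm_num
    | succ k hk ih =>
      have h4 : 4 ^ (k + 1) = 4 * 4 ^ k := by ring
      have h2 : 2 ^ (k + 1) = 2 * 2 ^ k := by ring
      rw [h4, h2]
      have hpos : 0 < 2 ^ k := Nat.pow_pos (by norm_num)
      nlinarith [ih, hpos, Nat.zero_le k]
  /- 2. `θ M - θ m` counts the primes in `(m, M]` with weight `log p ≤ log M`. -/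
  have theta_sub_le_card_mul_log : ∀ {m M : ℕ}, m ≤ M →
      Chebyshev.theta M - Chebyshev.theta m ≤
        (((Ioc m M).filter Nat.Prime).card : ℝ) * Real.log M := by
    intro m M hmM
    have hθ : ∀ k : ℕ, Chebyshev.theta k = ∑ i ∈ Ioc 0 k, (if i.Prime then Real.log i else 0) := by
      intro k
      rw [Chebyshev.theta, Nat.floor_natCast, Finset.sum_filter]
    rw [hθ, hθ, ← Finset.sum_Ioc_consecutive _ (Nat.zero_le m) hmM]
    simp only [add_sub_cancel_left]
    rw [← Finset.sum_filter]
    have : ∀ p ∈ (Ioc m M).filter Nat.Prime, Real.log p ≤ Real.log M := by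
      intro p hp
      rw [Finset.mem_filter, Finset.mem_Ioc] at hp
      have hp0 : (0 : ℝ) < p := by exact_mod_cast hp.2.pos
      exact Real.log_le_log hp0 (by exact_mod_cast hp.1.2)
    calc ∑ p ∈ (Ioc m M).filter Nat.Prime, Real.log p
        ≤ ((Ioc m M).filter Nat.Prime).card • Real.log M := Finset.sum_le_card_nsmul _ _ _ this
      _ = (((Ioc m M).filter Nat.Prime).card : ℝ) * Real.log M := by rw [nsmul_eq_mul]
  /- 3. Chebyshev: for `j ≥ 6` the interval `(4^j, 4^(j+1)]` holds ≥ `4^j / (2 (j+1))` primes. -/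
  have card_primes_Ioc_ge : ∀ j : ℕ, 6 ≤ j →
      (4 : ℝ) ^ j / (2 * (j + 1)) ≤ (((Ioc (4 ^ j) (4 ^ (j + 1))).filter Nat.Prime).card : ℝ) := by
    intro j hj
    have hlog2 : 0 < Real.log 2 := Real.log_pos one_lt_two
    have h4pos : (0 : ℝ) < 4 ^ j := by positivity
    have hlog4 : Real.log 4 = 2 * Real.log 2 := by
      rw [show (4 : ℝ) = 2 ^ 2 by norm_num, Real.log_pow]; ring
    have hup : Chebyshev.theta ((4 ^ j : ℕ) : ℝ) ≤ 2 * Real.log 2 * (4 : ℝ) ^ j := by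
      have := Chebyshev.theta_le_log4_mul_x (x := ((4 ^ j : ℕ) : ℝ)) (by positivity)
      rw [hlog4] at this
      simpa using this
    have hlow := Chebyshev.theta_ge (4 ^ (j + 1))
    have hsqrt : Real.sqrt ((4 ^ (j + 1) : ℕ) : ℝ) = 2 ^ (j + 1) := by
      have e : ((4 ^ (j + 1) : ℕ) : ℝ) = ((2 : ℝ) ^ (j + 1)) ^ 2 := by
        push_cast
        rw [← pow_mul, show (4 : ℝ) = 2 ^ 2 by norm_num, ← pow_mul]
        ring_nf
      rw [e]
      exact Real.sqrt_sq (by positivity)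
    have hlogpow : Real.log ((4 ^ (j + 1) : ℕ) : ℝ) = 2 * (j + 1) * Real.log 2 := by
      push_cast
      rw [Real.log_pow, hlog4]; push_cast; ring
    have hlogsucc : Real.log (((4 ^ (j + 1) : ℕ) : ℝ) + 1) ≤ (2 * (j + 1) + 1) * Real.log 2 := by
      have h1 : (((4 ^ (j + 1) : ℕ) : ℝ) + 1) ≤ 2 * (4 : ℝ) ^ (j + 1) := by
        push_cast
        have : (1 : ℝ) ≤ 4 ^ (j + 1) := one_le_pow₀ (by norm_num)
        linarith
      calc Real.log (((4 ^ (j + 1) : ℕ) : ℝ) + 1) ≤ Real.log (2 * (4 : ℝ) ^ (j + 1)) :=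
            Real.log_le_log (by positivity) h1
        _ = (2 * (j + 1) + 1) * Real.log 2 := by
            rw [Real.log_mul (by norm_num) (by positivity), Real.log_pow, hlog4]; push_cast; ring
    rw [hsqrt, hlogpow] at hlow
    have hkey : (2 * j + 3 + 8 * (j + 1) * 2 ^ j : ℝ) ≤ 4 ^ j := by exact_mod_cast key_nat j hj
    have hkey2 : (2 * (j : ℝ) + 3 + 8 * ((j : ℝ) + 1) * 2 ^ j) * Real.log 2 ≤ 4 ^ j * Real.log 2 :=
      mul_le_mul_of_nonneg_right hkey hlog2.le
    have hQL : ((4 ^ (j + 1) : ℕ) : ℝ) * Real.log 2 = 4 * ((4 : ℝ) ^ j * Real.log 2) := by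
      push_cast; ring
    have hEL : (2 : ℝ) ^ (j + 1) * (2 * ((j : ℝ) + 1) * Real.log 2) =
        4 * ((2 : ℝ) ^ j * (j : ℝ) * Real.log 2) + 4 * ((2 : ℝ) ^ j * Real.log 2) := by ring
    have hdiff : Real.log 2 * (4 : ℝ) ^ j ≤
        Chebyshev.theta ((4 ^ (j + 1) : ℕ) : ℝ) - Chebyshev.theta ((4 ^ j : ℕ) : ℝ) := by
      linarith [hlow, hup, hlogsucc, hQL, hEL, hkey2]
    have hcount := theta_sub_le_card_mul_log (m := 4 ^ j) (M := 4 ^ (j + 1))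
      (Nat.pow_le_pow_right (by norm_num) (Nat.le_succ j))
    rw [hlogpow] at hcount
    have hfin := hdiff.trans hcount
    rw [div_le_iff₀ (by positivity)]
    by_contra hlt
    rw [not_le] at hlt
    have := mul_lt_mul_of_pos_right hlt hlog2
    linarith
  /- 4. Choice of the scale `j`: all largeness conditions hold eventually. -/
  have exists_good_j : ∀ (c : ℝ), 0 < c → ∀ n₀ : ℕ,
      ∃ j : ℕ, 6 ≤ j ∧ n₀ ≤ 2 * j + 2 ∧ Real.log (2 * (j : ℝ) + 3) ≤ c * (2 * (j : ℝ) + 2) ∧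
        256 * ((j : ℝ) + 1) < (2 : ℝ) ^ (2 * c * (j : ℝ)) := by
    intro c hc n₀
    have h1 : ∀ᶠ j : ℕ in atTop, 6 ≤ j := eventually_ge_atTop 6
    have h2 : ∀ᶠ j : ℕ in atTop, n₀ ≤ 2 * j + 2 :=
      (eventually_ge_atTop n₀).mono fun j hj => by omega
    have hlo := Real.isLittleO_log_id_atTop.bound (half_pos hc)
    have hT : Tendsto (fun j : ℕ => (2 * (j : ℝ) + 3)) atTop atTop := by
      have : Tendsto (fun j : ℕ => ((2 * j + 3 : ℕ) : ℝ)) atTop atTop :=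
        tendsto_natCast_atTop_atTop.comp
          (tendsto_atTop_mono (fun j => by dsimp only [id]; omega) tendsto_id)
      refine this.congr fun j => ?_
      push_cast; ring
    have h3 : ∀ᶠ j : ℕ in atTop, Real.log (2 * (j : ℝ) + 3) ≤ c * (2 * (j : ℝ) + 2) := by
      filter_upwards [hT.eventually hlo] with j hj
      have hj0 : (0 : ℝ) ≤ 2 * (j : ℝ) + 3 := by positivity
      rw [Real.norm_eq_abs, Real.norm_eq_abs, id, abs_of_nonneg hj0] at hj
      have := le_abs_self (Real.log (2 * (j : ℝ) + 3))
      have hjj : (0 : ℝ) ≤ j := Nat.cast_nonneg j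
      nlinarith
    set r : ℝ := (2 : ℝ) ^ (2 * c) with hr_def
    have hr : 1 < r := Real.one_lt_rpow one_lt_two (by positivity)
    have hlim := tendsto_pow_const_div_const_pow_of_one_lt 1 hr
    have h4 : ∀ᶠ j : ℕ in atTop, 256 * ((j : ℝ) + 1) < (2 : ℝ) ^ (2 * c * (j : ℝ)) := by
      filter_upwards [hlim.eventually (gt_mem_nhds (show (0 : ℝ) < 1 / 512 by norm_num)),
        eventually_ge_atTop 1] with j hj hj1
      have hrj : (0 : ℝ) < r ^ j := pow_pos (lt_trans one_pos hr) j
      rw [pow_one, div_lt_iff₀ hrj] at hj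
      have hpow : r ^ j = (2 : ℝ) ^ (2 * c * (j : ℝ)) := by
        rw [hr_def, ← Real.rpow_natCast, ← Real.rpow_mul (by norm_num)]
      rw [← hpow]
      have hj1' : (1 : ℝ) ≤ j := by exact_mod_cast hj1
      nlinarith
    obtain ⟨j, hj⟩ := (h1.and (h2.and (h3.and h4))).exists
    exact ⟨j, hj.1, hj.2.1, hj.2.2.1, hj.2.2.2⟩
  /- 5. The arithmetic of the final comparison. -/
  have arith : ∀ {c : ℝ}, 0 < c → ∀ {j n : ℕ}, 4 ≤ n → 2 * j + 2 ≤ n → n ≤ 2 * j + 3 →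
      256 * ((j : ℝ) + 1) < (2 : ℝ) ^ (2 * c * (j : ℝ)) → ∀ {C : ℝ},
      (2 : ℝ) ^ (2 * j) / (4 * ((j : ℝ) + 1)) ≤ C →
      (2 : ℝ) ^ ((2 - c) * (n : ℝ)) < C * (2 : ℝ) ^ (n - 3) := by
    intro c hc j n hn4 hjn1 hjn2 hjexp C hC
    have h1 : (2 : ℝ) ^ ((2 - c) * (n : ℝ)) = (2 : ℝ) ^ (2 * n) / (2 : ℝ) ^ (c * n) := by
      rw [show (2 - c) * (n : ℝ) = ((2 * n : ℕ) : ℝ) - c * n by push_cast; ring,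
        Real.rpow_sub two_pos, Real.rpow_natCast]
    have h2 : (2 : ℝ) ^ (2 * c * (j : ℝ)) ≤ (2 : ℝ) ^ (c * n) := by
      apply Real.rpow_le_rpow_of_exponent_le one_le_two
      have : (2 * j + 2 : ℝ) ≤ n := by exact_mod_cast hjn1
      nlinarith
    have h3 : (2 : ℝ) ^ (2 * n) ≤ (2 : ℝ) ^ (2 * j + n + 3) :=
      pow_le_pow_right₀ one_le_two (by omega)
    have h4 : (2 : ℝ) ^ (2 * j + n + 3) = 64 * (2 : ℝ) ^ (2 * j) * 2 ^ (n - 3) := by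
      rw [show 2 * j + n + 3 = (2 * j) + (n - 3) + 6 by omega, pow_add, pow_add]; norm_num; ring
    have hCge : (2 : ℝ) ^ (2 * j) ≤ 4 * ((j : ℝ) + 1) * C := by
      rwa [div_le_iff₀' (by positivity)] at hC
    have hCpos : 0 < C := lt_of_lt_of_le (by positivity) hC
    have h23 : (0 : ℝ) < 2 ^ (n - 3) := by positivity
    rw [h1, div_lt_iff₀ (by positivity)]
    calc (2 : ℝ) ^ (2 * n) ≤ 2 ^ (2 * j + n + 3) := h3
      _ = 64 * (2 : ℝ) ^ (2 * j) * 2 ^ (n - 3) := h4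
      _ ≤ 256 * ((j : ℝ) + 1) * C * 2 ^ (n - 3) := by nlinarith
      _ < (2 : ℝ) ^ (2 * c * (j : ℝ)) * C * 2 ^ (n - 3) := by
          have := mul_lt_mul_of_pos_right (mul_lt_mul_of_pos_right hjexp hCpos) h23
          linarith
      _ ≤ C * 2 ^ (n - 3) * (2 : ℝ) ^ (c * n) := by nlinarith [mul_pos hCpos h23]
  /- 6. The scale `n ∈ {2j+2, 2j+3}` whose dyadic window `(2^(n-2), 2^(n-1)]` is prime-rich. -/
  have exists_scale : ∀ {c : ℝ}, 0 < c → ∀ (j : ℕ), 6 ≤ j → ∀ {n₀ : ℕ}, n₀ ≤ 2 * j + 2 →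
      Real.log (2 * (j : ℝ) + 3) ≤ c * (2 * (j : ℝ) + 2) →
      256 * ((j : ℝ) + 1) < (2 : ℝ) ^ (2 * c * (j : ℝ)) →
      ∃ n : ℕ, n₀ ≤ n ∧ 4 ≤ n ∧ Real.log (n : ℝ) ≤ c * n ∧
        (2 : ℝ) ^ ((2 - c) * (n : ℝ)) <
          ((((Finset.Ioc (2 ^ (n - 2)) (2 ^ (n - 1))).filter Nat.Prime).card : ℕ) : ℝ) *
            (2 : ℝ) ^ (n - 3) := by
    intro c hc j hj6 n₀ hjn hjlog hjexp
    have hF := card_primes_Ioc_ge j hj6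
    have h4j : (4 : ℕ) ^ j = 2 ^ (2 * j) := by rw [pow_mul]; norm_num
    have h4j1 : (4 : ℕ) ^ (j + 1) = 2 ^ (2 * j + 2) := by
      rw [show 2 * j + 2 = 2 * (j + 1) by ring, pow_mul]; norm_num
    have hcover : (Finset.Ioc (4 ^ j) (4 ^ (j + 1))).filter Nat.Prime ⊆
        (Finset.Ioc (2 ^ (2 * j + 2 - 2)) (2 ^ (2 * j + 2 - 1))).filter Nat.Prime ∪
          (Finset.Ioc (2 ^ (2 * j + 3 - 2)) (2 ^ (2 * j + 3 - 1))).filter Nat.Prime := by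
      intro p hp
      rw [Finset.mem_filter, Finset.mem_Ioc, h4j, h4j1] at hp
      rw [Finset.mem_union]
      by_cases hle : p ≤ 2 ^ (2 * j + 1)
      · left
        rw [Finset.mem_filter, Finset.mem_Ioc, show 2 * j + 2 - 2 = 2 * j by omega,
          show 2 * j + 2 - 1 = 2 * j + 1 by omega]
        exact ⟨⟨hp.1.1, hle⟩, hp.2⟩
      · right
        rw [Finset.mem_filter, Finset.mem_Ioc, show 2 * j + 3 - 2 = 2 * j + 1 by omega,
          show 2 * j + 3 - 1 = 2 * j + 2 by omega]
        exact ⟨⟨lt_of_not_ge hle, hp.1.2⟩, hp.2⟩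
    have hcardR : (4 : ℝ) ^ j / (2 * (j + 1)) ≤
        (((Finset.Ioc (2 ^ (2 * j + 2 - 2)) (2 ^ (2 * j + 2 - 1))).filter Nat.Prime).card : ℝ) +
          (((Finset.Ioc (2 ^ (2 * j + 3 - 2)) (2 ^ (2 * j + 3 - 1))).filter Nat.Prime).card : ℝ) := by
      have := (Finset.card_le_card hcover).trans (Finset.card_union_le _ _)
      exact hF.trans (by exact_mod_cast this)
    have h4R : (4 : ℝ) ^ j = (2 : ℝ) ^ (2 * j) := by rw [pow_mul]; norm_num
    rw [h4R] at hcardR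
    rcases le_or_gt ((2 : ℝ) ^ (2 * j) / (4 * ((j : ℝ) + 1)))
        (((Finset.Ioc (2 ^ (2 * j + 2 - 2)) (2 ^ (2 * j + 2 - 1))).filter Nat.Prime).card)
      with hA | hB
    · refine ⟨2 * j + 2, hjn, by omega, ?_, arith hc (by omega) le_rfl (by omega) hjexp hA⟩
      push_cast
      have : Real.log (2 * (j : ℝ) + 2) ≤ Real.log (2 * (j : ℝ) + 3) :=
        Real.log_le_log (by positivity) (by linarith)
      linarith
    · have hB' : (2 : ℝ) ^ (2 * j) / (4 * ((j : ℝ) + 1)) ≤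
          ((Finset.Ioc (2 ^ (2 * j + 3 - 2)) (2 ^ (2 * j + 3 - 1))).filter Nat.Prime).card := by
        have e : (2 : ℝ) ^ (2 * j) / (2 * ((j : ℝ) + 1)) =
            2 * ((2 : ℝ) ^ (2 * j) / (4 * ((j : ℝ) + 1))) := by
          field_simp; ring
        linarith
      refine ⟨2 * j + 3, by omega, by omega, ?_, arith hc (by omega) (by omega) le_rfl hjexp hB'⟩
      push_cast
      nlinarith [hjlog, hc]
  /- 7. Small arithmetic facts used in the membership verification. -/
  have two_pow_eq_double : ∀ a b : ℕ, a = b + 1 → 2 ^ a = 2 * 2 ^ b := by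
    intro a b h; subst h; exact pow_succ' 2 b
  have testBit_zero_odd_pow_mod : ∀ k e q : ℕ, ((2 * k + 1) ^ e % (2 * q)).testBit 0 = true := by
    intro k e q
    rw [Nat.testBit_zero, Nat.mod_mod_of_dvd _ (dvd_mul_right 2 q), Nat.pow_mod]
    simp
  have card_filter_even : ∀ (q : ℕ) (hd : DecidablePred fun z : ℕ => z.testBit 0 = false),
      (@Finset.filter ℕ (fun z => z.testBit 0 = false) hd (Finset.range (2 * q))).card = q := by
    intro q hd
    have : (@Finset.filter ℕ (fun z => z.testBit 0 = false) hd (Finset.range (2 * q))) =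
        (Finset.range q).map ⟨fun m => 2 * m, mul_right_injective₀ two_ne_zero⟩ := by
      ext z
      simp only [Finset.mem_filter, Finset.mem_range, Finset.mem_map, Function.Embedding.coeFn_mk,
        Nat.testBit_zero, decide_eq_false_iff_not]
      constructor
      · rintro ⟨hz, hmod⟩
        exact ⟨z / 2, by omega, by omega⟩
      · rintro ⟨m, hm, rfl⟩
        exact ⟨by omega, by omega⟩
    rw [this, Finset.card_map, Finset.card_range]
  /- 8. The refutation proper. -/
  rintro ⟨c, hc, n₀, h⟩
  obtain ⟨j, hj6, hjn, hjlog, hjexp⟩ := exists_good_j c hc n₀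
  obtain ⟨n, hn0, hn4, hlog, hbig⟩ := exists_scale hc j hj6 hjn hjlog hjexp
  -- the counterexample family `(2q, 2k+1)`
  set F : Finset (ℕ × ℕ) :=
    (((Finset.Ioc (2 ^ (n - 2)) (2 ^ (n - 1))).filter Nat.Prime) ×ˢ Finset.range (2 ^ (n - 3))).map
      ⟨fun qk => (2 * qk.1, 2 * qk.2 + 1), by
        rintro ⟨a, b⟩ ⟨a', b'⟩ hab
        simp only [Prod.mk.injEq] at hab
        ext <;> simp <;> omega⟩ with hF_def
  have hcardF : (F.card : ℝ) =
      ((((Finset.Ioc (2 ^ (n - 2)) (2 ^ (n - 1))).filter Nat.Prime).card : ℕ) : ℝ) *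
        (2 : ℝ) ^ (n - 3) := by
    rw [hF_def, Finset.card_map, Finset.card_product, Finset.card_range]
    push_cast; ring
  have hb := h n hn0
  rw [← not_lt] at hb
  apply hb
  refine lt_of_lt_of_le hbig (le_trans (le_of_eq hcardF.symm)
    (Nat.cast_le.2 (Finset.card_le_card (s := F) ?_)))
  intro x hx
  rw [hF_def, Finset.mem_map] at hx
  obtain ⟨⟨q, k⟩, hqk, rfl⟩ := hx
  rw [Finset.mem_product, Finset.mem_range] at hqk
  obtain ⟨hqP, hk⟩ := hqk
  rw [Finset.mem_filter, Finset.mem_Ioc] at hqP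
  obtain ⟨⟨hqlo, hqhi⟩, hqprime⟩ := hqP
  dsimp only at hk hqlo hqhi hqprime
  -- powers of two as linear relations for omega
  have hA := two_pow_eq_double n (n - 1) (by omega)
  have hB := two_pow_eq_double (n - 1) (n - 2) (by omega)
  have hC := two_pow_eq_double (n - 2) (n - 3) (by omega)
  have hq2 : 2 ≠ q := by
    intro h2
    have : 2 ^ 2 ≤ 2 ^ (n - 2) := Nat.pow_le_pow_right (by norm_num) (by omega)
    omega
  have hqlt : q < 2 ^ (n - 1) := by
    rcases hqhi.lt_or_eq with hlt | heq
    · exact hlt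
    · exfalso
      have h2 : 2 ∣ q := by rw [heq]; exact dvd_pow_self 2 (by omega)
      have := (Nat.prime_dvd_prime_iff_eq Nat.prime_two hqprime).1 h2
      exact hq2 this
  have hcop : Nat.Coprime (2 * k + 1) (2 * q) := by
    refine Nat.Coprime.mul_right ?_ ?_
    · exact ((Nat.Prime.coprime_iff_not_dvd Nat.prime_two).2 (by omega)).symm
    · exact (Nat.coprime_of_lt_prime (by omega) (by omega) hqprime).symm
  have h0n : 0 < n := by omega
  simp only [Finset.mem_filter, Finset.mem_product, Finset.mem_range, Function.Embedding.coeFn_mk]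
  refine ⟨⟨by omega, by omega⟩, ⟨2, q, Nat.prime_two, hqprime, hq2, rfl⟩, by omega, by omega,
    hcop, ∅, {⟨0, h0n⟩}, fun _ => false, fun _ => false, fun _ => false, fun _ => false, ?_, ?_⟩
  · simpa using hlog
  · simp only [Finset.mem_singleton, forall_eq, Finset.notMem_empty,
      Finset.card_empty, Finset.card_singleton, testBit_zero_odd_pow_mod, reduceCtorEq, false_and,
      Finset.filter_false, Nat.cast_zero, zero_div, zero_sub, abs_neg, implies_true, and_self,
      if_true, zero_add, Nat.cast_one, pow_zero, mul_one, card_filter_even q]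
    have hq0 : (0 : ℝ) < q := by exact_mod_cast hqprime.pos
    have hqq : (q : ℝ) / ((2 * q : ℕ) : ℝ) = 1 / 2 := by
      push_cast
      field_simp
    rw [hqq, abs_of_pos (by norm_num : (0 : ℝ) < 1 / 2), Real.rpow_neg_one]
    have hlt1 : ((2 * q : ℕ) : ℝ) ^ (-c) < 1 :=
      Real.rpow_lt_one_of_one_lt_of_neg (by exact_mod_cast (show 1 < 2 * q by omega)) (by linarith)
    linarith

end Summit.QuantumAdvantage.QuantumAdvantage.Theorems
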